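import Summits.AtomisticToContinuum.Crystallization.Theorems.SlackRigidity.Negative.WitnessBasics

/-!
# `SlackRigidity` (stmt-AtomisticToContinuum-11960), negative side II: a witness is unique up to `O(3)`,
vertex-transitive at every tolerance, and uniformly discrete

Continuation of `WitnessBasics.lean` (same namespace).  `rigidFor_vertexTransitive` is the formal content
of the route's remark "as typed P must be vertex-transitive (hcp, fcc are)": if the Lennard-Jones optimum
were a dhcp/6H/9R-type polytype (inequivalent h/c sites), the crux would be false for EVERY `P` although
one-`P` crystallisation could still hold.  Inputs: ground states (`gs`), their uniform separation, and the
packing bound `card_le_of_separated_of_dist_le` of the tree.  All `[folklore]`.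
-/



noncomputable section

open scoped BigOperators Topology
open Filter Set Metric

namespace Summit.AtomisticToContinuum.Crystallization.Theorems.SlackRigidityNegative

open Literature.MathematicalPhysics.StatisticalMechanics
open Summit.AtomisticToContinuum.Crystallization.Theses.ThreeConeCertificate (SlackRigidity)


/-! ## § Counting lemmas (general "few bad indices" bookkeeping) -/

/-- "Few bad": the fraction of indices `i : Fin N` violating `G N` tends to `0`. [folklore] -/
def FewBad (G : (N : ℕ) → Fin N → Prop) : Prop :=
  Tendsto (fun N : ℕ => (Nat.card {i : Fin N // ¬ G N i} : ℝ) / N) atTop (𝓝 0)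

/-- The crux's conclusion is `FewBad` of the matching predicate (definitional). [folklore] -/
theorem badFractionVanishes_iff_fewBad {P : PeriodicConfiguration 3} {R ε : ℝ}
    {x : (N : ℕ) → Fin N → E3} :
    BadFractionVanishes P R ε x ↔ FewBad fun N i => Good P R ε (x N) i := Iff.rfl

/-- A vanishing bad fraction puts the bad count eventually below `c N` for every `c > 0`. [folklore] -/
theorem FewBad.eventually_lt {G : (N : ℕ) → Fin N → Prop} (h : FewBad G) {c : ℝ} (hc : 0 < c) :
    ∀ᶠ N in atTop, (Nat.card {i : Fin N // ¬ G N i} : ℝ) < c * N := by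
  have h1 : ∀ᶠ N in atTop, (Nat.card {i : Fin N // ¬ G N i} : ℝ) / N < c :=
    (tendsto_order.1 h).2 c hc
  filter_upwards [h1, eventually_ge_atTop 1] with N hN hN1
  have hNpos : (0 : ℝ) < N := by exact_mod_cast hN1
  rwa [div_lt_iff₀ hNpos] at hN

/-- Two vanishing bad fractions leave, eventually, an index good for both. [folklore] -/
theorem FewBad.eventually_exists_good_good {G G' : (N : ℕ) → Fin N → Prop} (h : FewBad G)
    (h' : FewBad G') : ∀ᶠ N in atTop, ∃ i : Fin N, G N i ∧ G' N i := by
  classical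
  filter_upwards [h.eventually_lt one_half_pos, h'.eventually_lt one_half_pos] with N h1 h2
  by_contra hno
  have hsub : (Finset.univ : Finset (Fin N)) ⊆
      (Finset.univ.filter fun i => ¬ G N i) ∪ (Finset.univ.filter fun i => ¬ G' N i) := by
    intro i _
    rw [Finset.mem_union, Finset.mem_filter, Finset.mem_filter]
    by_cases hg : G N i
    · exact Or.inr ⟨Finset.mem_univ _, fun hg' => hno ⟨i, hg, hg'⟩⟩
    · exact Or.inl ⟨Finset.mem_univ _, hg⟩
  have hcard := (Finset.card_le_card hsub).trans (Finset.card_union_le _ _)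
  have e1 : Nat.card {i : Fin N // ¬ G N i} = (Finset.univ.filter fun i => ¬ G N i).card := by
    rw [Nat.card_eq_fintype_card, Fintype.card_subtype]
  have e2 : Nat.card {i : Fin N // ¬ G' N i} = (Finset.univ.filter fun i => ¬ G' N i).card := by
    rw [Nat.card_eq_fintype_card, Fintype.card_subtype]
  rw [Finset.card_univ, Fintype.card_fin, ← e1, ← e2] at hcard
  have : (N : ℝ) ≤ (Nat.card {i : Fin N // ¬ G N i} : ℝ) + Nat.card {i : Fin N // ¬ G' N i} := by
    exact_mod_cast hcard
  linarith

/-- Conjugation `A₁⁻¹ ∘ A₂` of linear isometries of `ℝ³` (finite dimension upgrades `A₁` to an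
equivalence). [folklore] -/
def conj (A₁ A₂ : E3 →ₗᵢ[ℝ] E3) : E3 →ₗᵢ[ℝ] E3 :=
  (A₁.toLinearIsometryEquiv rfl).symm.toLinearIsometry.comp A₂

/-- `dist q' (p₀ + A₁⁻¹ A₂ q) = dist (A₁ q') (A₁ p₀ + A₂ q)`. [folklore] -/
theorem dist_conj (A₁ A₂ : E3 →ₗᵢ[ℝ] E3) (p₀ q q' : E3) :
    dist q' (p₀ + conj A₁ A₂ q) = dist (A₁ q') (A₁ p₀ + A₂ q) := by
  rw [← (A₁.toLinearIsometryEquiv rfl).dist_map q' (p₀ + conj A₁ A₂ q), map_add]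
  simp [conj]

/-! ## § Necessary conditions on a witness (continued): uniqueness and vertex-transitivity -/

/-- **Two witnesses are congruent** up to a linear isometry, at every radius and tolerance:
ground states are matched to both, so around a doubly-good particle `A₁ P ≈ A₂ P'`.
(`S` pins the witness uniquely up to `O(3)`: no second, non-congruent `P` can ever be "also
true".) [folklore] -/
theorem rigidFor_unique_up_to_isometry {P P' : PeriodicConfiguration 3} (hP : RigidFor P)
    (hP' : RigidFor P') {R ε : ℝ} (hR : 0 < R) (hε : 0 < ε) :
    ∃ B : E3 →ₗᵢ[ℝ] E3,
      (∀ p ∈ P.points, ‖p‖ ≤ R → ∃ p' ∈ P'.points, dist p' (B p) ≤ ε) ∧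
      (∀ p' ∈ P'.points, ‖p'‖ ≤ R → ∃ p ∈ P.points, dist p' (B p) ≤ ε) := by
  obtain ⟨ε₁, hε₁, hε₁ε, hε₁1⟩ : ∃ ε₁ : ℝ, 0 < ε₁ ∧ 2 * ε₁ ≤ ε ∧ ε₁ ≤ 1 :=
    ⟨min (ε / 2) 1, lt_min (by linarith) one_pos, by linarith [min_le_left (ε / 2) (1 : ℝ)],
      min_le_right _ _⟩
  have h1 := hP (R + 1) ε₁ (by linarith) hε₁ gs gs_injective excessVanishes_gs
  have h2 := hP' (R + 1) ε₁ (by linarith) hε₁ gs gs_injective excessVanishes_gs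
  obtain ⟨N, i, ⟨A₁, ha1, hb1⟩, ⟨A₂, ha2, hb2⟩⟩ :=
    (FewBad.eventually_exists_good_good (G := fun N i => Good P (R + 1) ε₁ (gs N) i)
      (G' := fun N i => Good P' (R + 1) ε₁ (gs N) i) h1 h2).exists
  have hconj : ∀ p p' : E3, dist p' (conj A₂ A₁ p) = dist (A₂ p') (A₁ p) := fun p p' => by
    have := dist_conj A₂ A₁ 0 p p'
    rwa [zero_add, map_zero, zero_add] at this
  refine ⟨conj A₂ A₁, fun p hp hpR => ?_, fun p' hp' hp'R => ?_⟩
  · obtain ⟨j, hj⟩ := ha1 p hp (by linarith)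
    have hji : dist (gs N j) (gs N i) ≤ R + 1 :=
      calc dist (gs N j) (gs N i)
          ≤ dist (gs N j) (gs N i + A₁ p) + dist (gs N i + A₁ p) (gs N i) := dist_triangle _ _ _
        _ ≤ ε₁ + ‖p‖ := by rw [dist_add_linearIsometry]; linarith
        _ ≤ R + 1 := by linarith
    obtain ⟨p', hp', hjp'⟩ := hb2 j hji
    refine ⟨p', hp', ?_⟩
    rw [hconj]
    calc dist (A₂ p') (A₁ p) = dist (gs N i + A₂ p') (gs N i + A₁ p) := (dist_add_left _ _ _).symm
      _ ≤ dist (gs N i + A₂ p') (gs N j) + dist (gs N j) (gs N i + A₁ p) := dist_triangle _ _ _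
      _ ≤ ε₁ + ε₁ := by rw [dist_comm] at hjp'; linarith
      _ ≤ ε := by linarith
  · obtain ⟨j, hj⟩ := ha2 p' hp' (by linarith)
    have hji : dist (gs N j) (gs N i) ≤ R + 1 :=
      calc dist (gs N j) (gs N i)
          ≤ dist (gs N j) (gs N i + A₂ p') + dist (gs N i + A₂ p') (gs N i) := dist_triangle _ _ _
        _ ≤ ε₁ + ‖p'‖ := by rw [dist_add_linearIsometry]; linarith
        _ ≤ R + 1 := by linarith
    obtain ⟨p, hp, hjp⟩ := hb1 j hji
    refine ⟨p, hp, ?_⟩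
    rw [hconj]
    calc dist (A₂ p') (A₁ p) = dist (gs N i + A₂ p') (gs N i + A₁ p) := (dist_add_left _ _ _).symm
      _ ≤ dist (gs N i + A₂ p') (gs N j) + dist (gs N j) (gs N i + A₁ p) := dist_triangle _ _ _
      _ ≤ ε₁ + ε₁ := by rw [dist_comm] at hj; linarith
      _ ≤ ε := by linarith

/-- **A witness is vertex-transitive up to linear isometries, at every tolerance**: for every
point `p₀ ∈ P.points` and every `(R, ε)` there is a linear isometry `B` with
`(P.points − p₀) ∩ B_R` two-way `ε`-matched to `B (P.points)`.  Proof: in a large ground state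
most particles are good at radius `‖p₀‖ + R + 1`; a packing count (fibres of the map "good
particle ↦ the particle sitting at its image of `p₀`" have size `≤ (2(‖p₀‖+ε₁)/δ + 1)³` by the
uniform separation `δ`) produces a good particle whose `p₀`-neighbour is also good; comparing
their two matchings gives `B = A₁⁻¹ A₂`.

CONSEQUENCE (the typed statement's extra content): hcp and fcc (one orbit of sites under the
space group) can be witnesses; dhcp/4H, 6H, 9R, and every longer close-packed polytype have both
h- and c-type sites whose 12-shells (anticuboctahedron vs cuboctahedron) are not congruent, so at
`R` just above the neighbour distance and small `ε` they violate this conclusion — if the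
Lennard-Jones optimum were such a polytype, `SlackRigidity` would be false for EVERY `P`
(for `P = hcp` because ground states would then not be hcp-like), although "crystallisation
onto one periodic `P`" would still hold. [folklore] -/
theorem rigidFor_vertexTransitive {P : PeriodicConfiguration 3} (hP : RigidFor P) {p₀ : E3}
    (hp₀ : p₀ ∈ P.points) {R ε : ℝ} (hR : 0 < R) (hε : 0 < ε) :
    ∃ B : E3 →ₗᵢ[ℝ] E3,
      (∀ q ∈ P.points, ‖q‖ ≤ R → ∃ q' ∈ P.points, dist q' (p₀ + B q) ≤ ε) ∧
      (∀ q' ∈ P.points, dist q' p₀ ≤ R → ∃ q ∈ P.points, dist q' (p₀ + B q) ≤ ε) := by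
  classical
  obtain ⟨δ, hδ, hsep⟩ := gs_separated
  obtain ⟨ε₁, hε₁, hε₁ε, hε₁1⟩ : ∃ ε₁ : ℝ, 0 < ε₁ ∧ 3 * ε₁ ≤ ε ∧ 2 * ε₁ ≤ 1 :=
    ⟨min (ε / 3) (1 / 2), lt_min (by linarith) (by norm_num),
      by linarith [min_le_left (ε / 3) (1 / 2 : ℝ)], by linarith [min_le_right (ε / 3) (1 / 2 : ℝ)]⟩
  set R₁ : ℝ := ‖p₀‖ + R + 1 with hR₁
  have hR₁pos : 0 < R₁ := by positivity
  have hfew : FewBad fun N i => Good P R₁ ε₁ (gs N) i :=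
    hP R₁ ε₁ hR₁pos hε₁ gs gs_injective excessVanishes_gs
  set C : ℝ := (2 * (‖p₀‖ + ε₁) / δ + 1) ^ Module.finrank ℝ E3 with hC
  have hCpos : 0 < C := by positivity
  set c : ℝ := 1 / (2 * (C + 1)) with hc
  have hcpos : 0 < c := by positivity
  obtain ⟨N, hlt, hN1⟩ := ((hfew.eventually_lt hcpos).and (eventually_ge_atTop 1)).exists
  haveI : Nonempty (Fin N) := ⟨⟨0, hN1⟩⟩
  haveI : Nonempty (E3 →ₗᵢ[ℝ] E3) := ⟨LinearIsometry.id⟩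
  set x := gs N with hx
  have hxinj : Function.Injective x := gs_injective N
  have hxsep : ∀ a a' : Fin N, a ≠ a' → δ ≤ dist (x a) (x a') := hsep N
  -- choices attached to good particles
  have hchoice : ∀ i : Fin N, Good P R₁ ε₁ x i → ∃ A : E3 →ₗᵢ[ℝ] E3, ∃ j : Fin N,
      (∀ p ∈ P.points, ‖p‖ ≤ R₁ → ∃ k : Fin N, dist (x k) (x i + A p) ≤ ε₁) ∧
      (∀ k : Fin N, dist (x k) (x i) ≤ R₁ → ∃ p ∈ P.points, dist (x k) (x i + A p) ≤ ε₁) ∧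
      dist (x j) (x i + A p₀) ≤ ε₁ := by
    rintro i ⟨A, ha, hb⟩
    obtain ⟨j, hj⟩ := ha p₀ hp₀ (by rw [hR₁]; linarith)
    exact ⟨A, j, ha, hb, hj⟩
  choose! A j hA hB hj using hchoice
  set G := Finset.univ.filter fun i => Good P R₁ ε₁ x i with hG
  set Bd := Finset.univ.filter fun i => ¬ Good P R₁ ε₁ x i with hBd
  have hBd_card : (Bd.card : ℝ) < c * N := by
    have e : Nat.card {i : Fin N // ¬ Good P R₁ ε₁ x i} = Bd.card := by
      rw [Nat.card_eq_fintype_card, Fintype.card_subtype]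
    have := hlt
    rw [e] at this
    exact this
  have hGB : (G.card : ℝ) + Bd.card = N := by
    have := Finset.card_filter_add_card_filter_not
      (s := (Finset.univ : Finset (Fin N))) (fun i => Good P R₁ ε₁ x i)
    rw [Finset.card_univ, Fintype.card_fin] at this
    exact_mod_cast this
  -- some good particle has a good `p₀`-neighbour
  have hexists : ∃ i ∈ G, j i ∈ G := by
    by_contra hno
    have hmaps : ∀ i ∈ G, j i ∈ Bd := by
      intro i hi
      rw [hBd, Finset.mem_filter]
      refine ⟨Finset.mem_univ _, fun hgood => hno ⟨i, hi, ?_⟩⟩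
      rw [hG, Finset.mem_filter]
      exact ⟨Finset.mem_univ _, hgood⟩
    have hfib : ∀ b ∈ Bd, ((G.filter fun a => j a = b).card : ℝ) ≤ C := by
      intro b _
      have hcard : (((G.filter fun a => j a = b).image x).card : ℝ) =
          (G.filter fun a => j a = b).card := by
        rw [Finset.card_image_of_injective _ hxinj]
      rw [← hcard, hC]
      refine card_le_of_separated_of_dist_le ((G.filter fun a => j a = b).image x) (x b) hδ
        (by positivity) ?_ ?_
      · intro cpt hcpt
        obtain ⟨a, ha, rfl⟩ := Finset.mem_image.1 hcpt
        have haG : a ∈ G := (Finset.mem_filter.1 ha).1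
        have hja : j a = b := (Finset.mem_filter.1 ha).2
        have hgood : Good P R₁ ε₁ x a := (Finset.mem_filter.1 haG).2
        have hd := hj a hgood
        rw [hja] at hd
        calc dist (x a) (x b) = dist (x b) (x a) := dist_comm _ _
          _ ≤ dist (x b) (x a + A a p₀) + dist (x a + A a p₀) (x a) := dist_triangle _ _ _
          _ ≤ ε₁ + ‖p₀‖ := by rw [dist_add_linearIsometry]; linarith
          _ = ‖p₀‖ + ε₁ := by ring
      · intro cpt hcpt dpt hdpt hne
        obtain ⟨a, -, rfl⟩ := Finset.mem_image.1 hcpt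
        obtain ⟨a', -, rfl⟩ := Finset.mem_image.1 hdpt
        exact hxsep a a' (fun h => hne (by rw [h]))
    have hsum : (G.card : ℝ) ≤ Bd.card * C := by
      have h1 : G.card = ∑ b ∈ Bd, (G.filter fun a => j a = b).card :=
        Finset.card_eq_sum_card_fiberwise hmaps
      have h2 : (G.card : ℝ) = ∑ b ∈ Bd, ((G.filter fun a => j a = b).card : ℝ) := by
        rw [h1]; exact Nat.cast_sum _ _
      rw [h2]
      calc ∑ b ∈ Bd, ((G.filter fun a => j a = b).card : ℝ) ≤ ∑ b ∈ Bd, C :=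
            Finset.sum_le_sum hfib
        _ = Bd.card * C := by rw [Finset.sum_const, nsmul_eq_mul]
    have hN : (1 : ℝ) ≤ N := by exact_mod_cast hN1
    have h3 : (N : ℝ) ≤ (C + 1) * Bd.card := by linarith
    have h4 : (C + 1) * (Bd.card : ℝ) < (C + 1) * (c * N) :=
      mul_lt_mul_of_pos_left hBd_card (by positivity)
    have hC1 : (C + 1) ≠ 0 := by positivity
    have hcC : (C + 1) * (c * N) = N / 2 := by
      rw [hc]; field_simp
    linarith
  obtain ⟨i, hiG, hjG⟩ := hexists
  have hgi : Good P R₁ ε₁ x i := (Finset.mem_filter.1 hiG).2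
  have hgj : Good P R₁ ε₁ x (j i) := (Finset.mem_filter.1 hjG).2
  have hy : dist (x (j i)) (x i + A i p₀) ≤ ε₁ := hj i hgi
  have hyi : dist (x (j i)) (x i) ≤ ε₁ + ‖p₀‖ :=
    calc dist (x (j i)) (x i) ≤ dist (x (j i)) (x i + A i p₀) + dist (x i + A i p₀) (x i) :=
          dist_triangle _ _ _
      _ ≤ ε₁ + ‖p₀‖ := by rw [dist_add_linearIsometry]; linarith
  refine ⟨conj (A i) (A (j i)), fun q hq hqR => ?_, fun q' hq' hq'R => ?_⟩
  · -- clause (a): points of `P` near `0`, transported to `p₀`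
    obtain ⟨k, hk⟩ := hA (j i) hgj q hq (by rw [hR₁]; linarith [norm_nonneg p₀])
    have hki : dist (x k) (x i) ≤ R₁ :=
      calc dist (x k) (x i)
          ≤ dist (x k) (x (j i) + A (j i) q) + dist (x (j i) + A (j i) q) (x (j i)) +
            dist (x (j i)) (x i) := dist_triangle4 _ _ _ _
        _ ≤ ε₁ + ‖q‖ + (ε₁ + ‖p₀‖) := by rw [dist_add_linearIsometry]; linarith
        _ ≤ R₁ := by rw [hR₁]; linarith
    obtain ⟨q'', hq'', hkq''⟩ := hB i hgi k hki
    refine ⟨q'', hq'', ?_⟩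
    rw [dist_conj]
    calc dist (A i q'') (A i p₀ + A (j i) q)
        = dist (x i + A i q'') (x i + A i p₀ + A (j i) q) := by rw [add_assoc, dist_add_left]
      _ ≤ dist (x i + A i q'') (x k) + dist (x k) (x (j i) + A (j i) q) +
            dist (x (j i) + A (j i) q) (x i + A i p₀ + A (j i) q) := dist_triangle4 _ _ _ _
      _ ≤ ε₁ + ε₁ + ε₁ := by
          rw [dist_add_right, dist_comm (x i + A i q'')]
          linarith
      _ ≤ ε := by linarith
  · -- clause (b): points of `P` near `p₀`, pulled back to `0`
    have hq'norm : ‖q'‖ ≤ R₁ :=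
      calc ‖q'‖ = ‖(q' - p₀) + p₀‖ := by rw [sub_add_cancel]
        _ ≤ ‖q' - p₀‖ + ‖p₀‖ := norm_add_le _ _
        _ = dist q' p₀ + ‖p₀‖ := by rw [dist_eq_norm]
        _ ≤ R₁ := by rw [hR₁]; linarith
    obtain ⟨k, hk⟩ := hA i hgi q' hq' hq'norm
    have hkj : dist (x k) (x (j i)) ≤ R₁ :=
      calc dist (x k) (x (j i))
          ≤ dist (x k) (x i + A i q') + dist (x i + A i q') (x i + A i p₀) +
            dist (x i + A i p₀) (x (j i)) := dist_triangle4 _ _ _ _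
        _ ≤ ε₁ + R + ε₁ := by
            rw [dist_add_left, LinearIsometry.dist_map, dist_comm (x i + A i p₀)]
            linarith
        _ ≤ R₁ := by rw [hR₁]; linarith [norm_nonneg p₀]
    obtain ⟨q, hq, hkq⟩ := hB (j i) hgj k hkj
    refine ⟨q, hq, ?_⟩
    rw [dist_conj]
    calc dist (A i q') (A i p₀ + A (j i) q)
        = dist (x i + A i q') (x i + A i p₀ + A (j i) q) := by rw [add_assoc, dist_add_left]
      _ ≤ dist (x i + A i q') (x k) + dist (x k) (x (j i) + A (j i) q) +
            dist (x (j i) + A (j i) q) (x i + A i p₀ + A (j i) q) := dist_triangle4 _ _ _ _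
      _ ≤ ε₁ + ε₁ + ε₁ := by
          rw [dist_add_right, dist_comm (x i + A i q')]
          linarith
      _ ≤ ε := by linarith

/-- **A witness is uniformly discrete with the ground-state separation `δ`** (tree: `1/3`):
combine `rigidFor_vertexTransitive` (look at `P` from the point `q`) with
`norm_le_of_mem_points_of_rigidFor` (punctured `δ`-ball about `0` is empty). So `S` pins the
witness to the scale of real ground states: no decorated / over-dense / accidental-coincidence
`P` can be slipped in. [folklore] -/
theorem rigidFor_uniformlyDiscrete : ∃ δ : ℝ, 0 < δ ∧ ∀ P : PeriodicConfiguration 3, RigidFor P →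
    ∀ p ∈ P.points, ∀ q ∈ P.points, p ≠ q → δ ≤ dist p q := by
  obtain ⟨δ, hδ, hall⟩ := norm_le_of_mem_points_of_rigidFor
  refine ⟨δ, hδ, fun P hP p hp q hq hpq => ?_⟩
  by_contra hlt
  rw [not_le] at hlt
  have hd : 0 < dist p q := dist_pos.2 hpq
  obtain ⟨ε, hε, hε1, hε2⟩ : ∃ ε : ℝ, 0 < ε ∧ ε ≤ dist p q / 3 ∧ ε ≤ (δ - dist p q) / 3 :=
    ⟨min (dist p q / 3) ((δ - dist p q) / 3), lt_min (by linarith) (by linarith), min_le_left _ _,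
      min_le_right _ _⟩
  obtain ⟨B, -, hb⟩ := rigidFor_vertexTransitive hP hq hd hε
  obtain ⟨q₀, hq₀, hpq₀⟩ := hb p hp le_rfl
  have hnorm : dist (q + B q₀) q = ‖q₀‖ := dist_add_linearIsometry B q q₀
  by_cases h0 : q₀ = 0
  · subst h0
    rw [map_zero, add_zero] at hpq₀
    linarith
  · have h1 := hall P hP q₀ hq₀ h0
    have h2 : ‖q₀‖ ≤ dist p q + ε := by
      rw [← hnorm]
      calc dist (q + B q₀) q ≤ dist (q + B q₀) p + dist p q := dist_triangle _ _ _
        _ ≤ ε + dist p q := by rw [dist_comm] at hpq₀; linarith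
        _ = dist p q + ε := by ring
    linarith

end Summit.AtomisticToContinuum.Crystallization.Theorems.SlackRigidityNegative

end
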